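import Literature.MathematicalPhysics.QuantumFieldTheory.Balaban1983to89.B13NodeTorusWalks

/-!
# `Balaban1983to89.B13NodeTorusWalksAccretive` — T. Bałaban, *Renormalization group approach to lattice gauge field
theories. II. Cluster expansions*, Commun. Math. Phys. **116** (1988) 1–22 [Balaban1988RG2Cluster], p. 15 and Lemmas 1–3:
**two of NODE A's structural inputs of N10's walks leaf are AUTOMATIC from the rung's accretivity** — at every
configuration of the ball the term precision `A(σ,u) = Δ^{(k)}(Z₀,σ,𝐔,𝐉)` has `Re A(σ,u) ≻ 0` (given complex symmetry),
and the reference covariance `C = A(0,0)⁻¹` has all eigenvalues `≤ 1∕m_A` — so `B13NodeTorusWalks.b13Leaf_twoTorus_walks` ∕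
`b13Leaf_twoTorus_uniformWalksAcross` hold WITHOUT the hypothesis `hA` and with the per-term eigenvalue hypothesis `hcE`
replaced by the NUMBER `1∕m_A ≤ c_E`.

statement-level bookkeeping over published theorems with citation tags; kernel-checked compositions of tree theorems;
nothing here is a claim about the Yang–Mills mass gap.

Cell `pub-ymgap`, HUMAN RULING D-0062 Track A, DAG node N10 = [B13]; R134 acceleration seat `pub-ymgap-dag-n10-c`, second
module (a NEW LEAF over `B13NodeTorusWalks`, p451225; nothing there modified).

WHY.  The W-walks datum of a (2.14)-term (`NodeOLettersOfWalksAcross.TermWalks 𝒦 q`) carries, besides the three joint walk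
expansions, the clause `accA`: `m_A·Σ|v_i|² ≤ Re⟨v, A(σ,u)v⟩` for every σ of the polydisc and every `u` of the `R`-ball —
print's p. 15 *"For the pair (U, 0) the operators are symmetric, and the measure is positive … The general case is handled
by a perturbative argument"* in the [Balaban1985BackgroundPropagators] Thm 3.10 currency.  NODE A's (2.15)∕(2.26) capstones
ask separately for `hA : (A(σ,u)).map re ≻ 0` (the complex Gaussian normalisation, `B13FirstEstimate215`) and for an
eigenvalue bound `c_E` of `C` (the (2.24)–(2.25) smallness).  Both are CONSEQUENCES of `accA` (elementary linear algebra):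
* §1 (private [folklore] helpers) `re_posDef_of_accretive` — a complex-symmetric `m`-accretive matrix (`m > 0`) has positive definite real
  part (test the accretivity on real vectors); `eigenvalues_le_of_inv_accretive` — if `A⁻¹ = C` with `C ≻ 0` real and `A`
  is `m`-accretive then every eigenvalue `λ` of `C` is `≤ 1∕m` (test the accretivity on `w = λe = Ce`, `e` the unit
  eigenvector: `mλ² ≤ λ`); the per-term readers `re_posDef_of_termWalks`, `eigenvalues_C_le_of_termWalks`.
* §2 **`b13Leaf_twoTorus_walks₂`** — `B13NodeTorusWalks.b13Leaf_twoTorus_walks` with `hA` REMOVED and `hcE` := the number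
  `1∕q.mA ≤ cE`; every other binder unchanged and in the same order.
* §3 **`b13Leaf_twoTorus_uniformWalksAcross₂`** — the FAN-OUT s3 shape (`UniformWalksAcross 𝓣 q` displayed, standard rate
  book, print's two thresholds) likewise reduced.
* §4 `exists_theta_of_vartheta` — (A2)-style compatibility of the NEW numeric coupling of the walks leaf: for any round
  letters `K_G, K_Cs ≥ 0`, any rate chain `κ″ < κ′ < κ < κ₂ < κ_C` and ANY target NODE-A smallness `ϑ > 0` there is
  `θ₀ ∈ ]0, ϑ]` meeting the letter inequality `hθR1le` — so print's two thresholds at that `θ₀` (α small, R_σ large: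
  `B13NodeTorusWalks.exchange_of_thresholds`) serve NODE A's letter; pure arithmetic.
WHAT REMAINS BY ASSERTION in N10's walks leaf after this file: the rung for BAŁABAN's kernels (NODE A's object content =
in-edge N06), complex symmetry `hAs` of the term precision on the polydisc, the linear-map reading `hlin`, separate
holomorphy of the X-integral, termwise domination, `Γ₀`'s form bound `hΓq`, the in-edges (1.24)∕(1.30), identifications of
a NODE-00 pin, numbers.

CITATIONS.  [Balaban1988RG2Cluster] p. 15 (quoted above), (2.14)–(2.16) pp. 15–16, (2.24)–(2.26) p. 17, Lemmas 1–3 pp. 9,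
11, 20; [Balaban1985BackgroundPropagators] Thm 3.10 p. 416.

HONEST FRAMING: elementary linear algebra + by-name composition; NOTHING of Bałaban's operators is constructed; the rung
`UniformWalksAcross 𝓣_Bałaban q` remains the HYPOTHESIS; count-neutral Track-A side landing; N10 NOT discharged; one finite
four-torus; Bałaban AS PRINTED with page locators; nothing continuum ∕ ℝ⁴ ∕ OS ∕ mass-gap ∕ Clay.  0 `sorry`, 0 `def`, no
instance, no notation; standard axioms.
-/

noncomputable section

namespace Literature.MathematicalPhysics.QuantumFieldTheory.Balaban1983to89.B13NodeTorusWalksAccretive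

open Metric Set
open Literature.MathematicalPhysics.QuantumFieldTheory.Balaban1983to89
open Literature.MathematicalPhysics.QuantumFieldTheory.Balaban1983to89.B16Absorption (pbox)
open Literature.MathematicalPhysics.QuantumFieldTheory.Balaban1983to89.TreeLengthTorus
open Literature.MathematicalPhysics.QuantumFieldTheory.Balaban1983to89.TreeLengthTorusGeometry
open Literature.MathematicalPhysics.QuantumFieldTheory.Balaban1983to89.TreeLengthTorusTransfer
open Literature.MathematicalPhysics.QuantumFieldTheory.Balaban1983to89.B12TreeDecay (kappa₀ K₀)
open Literature.MathematicalPhysics.QuantumFieldTheory.Balaban1983to89.B13Lemma3TorusData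
open Literature.MathematicalPhysics.QuantumFieldTheory.Balaban1983to89.B13Lemma3Torus (TwoTorusStep)
open Literature.MathematicalPhysics.QuantumFieldTheory.Balaban1983to89.B13Lemma3TorusSocket (Lemma3Numerics)
open Literature.MathematicalPhysics.QuantumFieldTheory.Balaban1983to89.B13PkScaling (Qop scaled)
open Literature.MathematicalPhysics.QuantumFieldTheory.Balaban1983to89.DagBinding
open Literature.MathematicalPhysics.QuantumFieldTheory.Balaban1983to89.B13Bound143 (invTau R12)
open Literature.MathematicalPhysics.QuantumFieldTheory.Balaban1983to89.B13Term214 (term214 SepHolOn core214 F214)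
open Literature.MathematicalPhysics.QuantumFieldTheory.Balaban1983to89.B13Lemma3TorusTerms (terms weight Z0)
open Literature.MathematicalPhysics.QuantumFieldTheory.Balaban1983to89.B5TorusCover (UT)
open Literature.MathematicalPhysics.QuantumFieldTheory.Balaban1983to89.B9Thm37GlueTorus (tdist1)
open Literature.MathematicalPhysics.QuantumFieldTheory.Balaban1983to89.B13TermWalkData (TermKernels TorusTerms)
open Literature.MathematicalPhysics.QuantumFieldTheory.Balaban1983to89.NodeOLettersOfWalksAcross
  (WalkPackage RateBook TermWalks UniformWalksAcross)
open Literature.MathematicalPhysics.QuantumFieldTheory.Balaban1983to89.B13NodeTorusWalks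
  (b13Leaf_twoTorus_walks exchange_of_thresholds termWalks_of_uniformWalksAcross)

/-! ## §1. Accretivity ⟹ positive real part, and an eigenvalue bound of the reference covariance -/

section LinearAlgebra

open Matrix Finset

/-- **A complex-symmetric `m`-accretive matrix has positive definite real part** (`m > 0`): if `Aᵀ = A` and
`m·Σ_i|v_i|² ≤ Re Σ_i v̄_i (Av)_i` for every complex vector `v`, then the real matrix `Re A` is symmetric and
`xᵀ(Re A)x ≥ m|x|² > 0` for real `x ≠ 0` (the accretivity tested on real vectors); private helper of the per-term reader
`re_posDef_of_termWalks` below. [folklore] -/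
private theorem re_posDef_of_accretive {n : Type} [Fintype n] [DecidableEq n] {A : Matrix n n ℂ} (hAs : A.IsSymm)
    {m : ℝ} (hm : 0 < m)
    (hacc : ∀ v : n → ℂ, m * ∑ i, ‖v i‖ ^ 2 ≤ (∑ i, star (v i) * (A *ᵥ v) i).re) :
    (A.map Complex.re).PosDef := by
  refine Matrix.PosDef.of_dotProduct_mulVec_pos ?_ ?_
  · -- Hermitian over ℝ = symmetric
    show (A.map Complex.re)ᴴ = A.map Complex.re
    rw [conjTranspose_eq_transpose_of_trivial]
    exact hAs.map _
  · intro x hx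
    -- embed the real vector into ℂ
    set v : n → ℂ := fun i => (x i : ℂ) with hv
    have key : (∑ i, star (v i) * (A *ᵥ v) i).re = star x ⬝ᵥ ((A.map Complex.re) *ᵥ x) := by
      simp [hv, dotProduct, Matrix.mulVec, Matrix.map_apply, Complex.re_sum, Finset.mul_sum]
    have hpos : 0 < ∑ i, ‖v i‖ ^ 2 := by
      obtain ⟨i, hi⟩ := Function.ne_iff.1 hx
      have hle : ‖v i‖ ^ 2 ≤ ∑ j, ‖v j‖ ^ 2 :=
        Finset.single_le_sum (f := fun j => ‖v j‖ ^ 2) (fun j _ => sq_nonneg _) (Finset.mem_univ i)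
      have hvi : 0 < ‖v i‖ ^ 2 := by
        have : v i ≠ 0 := by simpa [hv] using hi
        positivity
      linarith
    have h := hacc v
    rw [key] at h
    exact lt_of_lt_of_le (mul_pos hm hpos) h

/-- **Eigenvalue bound of the inverse of an accretive matrix**: if `A⁻¹ = C` (complexified) with `C ≻ 0` real and `A` is
`m`-accretive (`m > 0`) then every eigenvalue `λ` of `C` satisfies `λ ≤ 1∕m` — test the accretivity on `w = Ce = λe` for
the unit eigenvector `e`: `A w = e`, so `mλ² = m|w|² ≤ Re⟨w, Aw⟩ = λ`; private helper of the per-term reader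
`eigenvalues_C_le_of_termWalks` below. [folklore] -/
private theorem eigenvalues_le_of_inv_accretive {n : Type} [Fintype n] [DecidableEq n] {A : Matrix n n ℂ}
    {C : Matrix n n ℝ} (hC : C.PosDef) (hC0 : A⁻¹ = C.map (algebraMap ℝ ℂ))
    {m : ℝ} (hm : 0 < m)
    (hacc : ∀ v : n → ℂ, m * ∑ i, ‖v i‖ ^ 2 ≤ (∑ i, star (v i) * (A *ᵥ v) i).re) (i : n) :
    hC.1.eigenvalues i ≤ 1 / m := by
  -- the eigenpair
  set lam : ℝ := hC.1.eigenvalues i with hlam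
  set e : n → ℝ := ⇑(hC.1.eigenvectorBasis i) with he
  have hCe : C *ᵥ e = lam • e := hC.1.mulVec_eigenvectorBasis i
  have hnorm : ∑ j, (e j) ^ 2 = 1 := by
    have h1 : ‖hC.1.eigenvectorBasis i‖ = 1 := hC.1.eigenvectorBasis.orthonormal.1 i
    have h2 := EuclideanSpace.real_norm_sq_eq (hC.1.eigenvectorBasis i)
    rw [h1, one_pow] at h2
    exact h2.symm
  -- A is invertible, its inverse being C (complexified)
  have hCu : IsUnit C.det := hC.det_pos.ne'.isUnit
  have hmul : C⁻¹.map (algebraMap ℝ ℂ) * C.map (algebraMap ℝ ℂ) = 1 := by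
    rw [← Matrix.map_mul, Matrix.nonsing_inv_mul C hCu, Matrix.map_one _ (map_zero _) (map_one _)]
  have hCmu : IsUnit (C.map (algebraMap ℝ ℂ)) :=
    (Matrix.isUnit_iff_isUnit_det _).2 (Matrix.isUnit_det_of_left_inverse hmul)
  have hAu : IsUnit A.det := by
    rw [← Matrix.isUnit_iff_isUnit_det, ← Matrix.isUnit_nonsing_inv_iff, hC0]; exact hCmu
  -- the complex vector w := C e = lam • e, with A w = e
  set ec : n → ℂ := fun j => (e j : ℂ) with hec
  set w : n → ℂ := fun j => ((lam * e j : ℝ) : ℂ) with hw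
  have hw' : w = (C.map (algebraMap ℝ ℂ)) *ᵥ ec := by
    funext j
    have h := RingHom.map_mulVec (algebraMap ℝ ℂ) C e j
    rw [hCe] at h
    simpa [hw, hec, Function.comp_def, Pi.smul_apply, smul_eq_mul] using h
  have hAw : A *ᵥ w = ec := by
    rw [hw', ← hC0, Matrix.mulVec_mulVec, Matrix.mul_nonsing_inv A hAu, Matrix.one_mulVec]
  -- the accretivity at w reads `m lam² ≤ lam`
  have h := hacc w
  rw [hAw] at h
  have hL : ∑ j, ‖w j‖ ^ 2 = lam ^ 2 := by
    have : ∀ j, ‖w j‖ ^ 2 = lam ^ 2 * (e j) ^ 2 := fun j => by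
      rw [hw]; simp only [Complex.norm_real, Real.norm_eq_abs, sq_abs]; ring
    simp_rw [this, ← Finset.mul_sum, hnorm, mul_one]
  have hR : (∑ j, star (w j) * ec j).re = lam := by
    have : ∀ j, star (w j) * ec j = (((lam * e j) * e j : ℝ) : ℂ) := fun j => by
      simp [hw, hec, Complex.conj_ofReal]
    simp_rw [this]
    rw [← Complex.ofReal_sum]
    simp only [Complex.ofReal_re]
    have : ∑ j, lam * e j * e j = lam * ∑ j, (e j) ^ 2 := by rw [Finset.mul_sum]; congr 1; funext j; ring
    rw [this, hnorm, mul_one]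
  rw [hL, hR] at h
  rw [le_div_iff₀ hm]
  nlinarith

end LinearAlgebra

/-! ## §1 (continued). The per-term readers: `Re A(σ,u) ≻ 0` and `spec C ≤ 1∕m_A` from the W-walks datum -/

section OneTerm

variable {c : B13.Consts} {d N' ν : ℕ} {Nf : Fin ν → ℕ} [∀ i, NeZero (Nf i)]
variable {E : Type*} [NormedAddCommGroup E] [NormedSpace ℂ E]

/-- **`Re A(σ,u) ≻ 0` FROM THE RUNG**: a term carrying `TermWalks 𝒦 q` (`q` admissible) has, at every σ of the polydisc
`‖σ_j‖ ≤ e^{κ₁}` and every configuration `‖u‖ < R` at which `A(σ,u)` is complex symmetric, `(A(σ,u)).map re ≻ 0` — NODE A's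
input `hA` of the (2.15)∕(2.26) capstones, by the m_A-accretivity clause `accA` ([II] p. 15 *"the measure is positive …
perturbative argument"*). [cite: Balaban1988RG2Cluster, p.15, (2.14)–(2.15) p.15] -/
theorem re_posDef_of_termWalks {𝒦 : TermKernels c d N' ν Nf E} [Fintype 𝒦.C₀] [DecidableEq 𝒦.C₀] {q : WalkPackage}
    (hq : q.Admissible) (hw : TermWalks 𝒦 q) {u : E} (hu : ‖u‖ < q.R)
    (σ : TPt d N' → ℂ) (hσ : ∀ j, ‖σ j‖ ≤ Real.exp c.κ₁) (hAs : (𝒦.A2 σ u).IsSymm) :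
    ((𝒦.A2 σ u).map Complex.re).PosDef :=
  re_posDef_of_accretive hAs hq.hmA (hw.accA σ hσ u (mem_ball_zero_iff.2 hu))

/-- **THE REFERENCE COVARIANCE's SPECTRUM FROM THE RUNG**: a term carrying `TermWalks 𝒦 q` (`q` admissible) has every
eigenvalue of `C = A(0,0)⁻¹ ≻ 0` bounded by `1∕m_A` (accretivity at σ = 0, u = 0) — the eigenvalue bound `c_E` of the
(2.24)–(2.25) smallness is a NUMBER of the package. [cite: Balaban1988RG2Cluster, p.15, (2.24)–(2.25) p.17] -/
theorem eigenvalues_C_le_of_termWalks {𝒦 : TermKernels c d N' ν Nf E} [Fintype 𝒦.C₀] [DecidableEq 𝒦.C₀]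
    {q : WalkPackage} (hq : q.Admissible) (hw : TermWalks 𝒦 q) (i : 𝒦.Λ) :
    𝒦.hC.1.eigenvalues i ≤ 1 / q.mA :=
  eigenvalues_le_of_inv_accretive 𝒦.hC 𝒦.hC0 hq.hmA
    (hw.accA 0 (fun _ => by rw [Pi.zero_apply, norm_zero]; exact (Real.exp_pos _).le) 0 (mem_ball_self hq.hR)) i

end OneTerm

/-! ## §2. The walks leaf WITHOUT `hA` and with `c_E` a number -/

section Walks

variable {L N' : ℕ} [NeZero L] [NeZero N']

open Matrix

open Classical in
/-- **N10's LEAF TRIPLE ON THE TWO-SCALE TORUS FROM THE W-WALKS RUNG — `Re A ≻ 0` AND THE SPECTRUM OF `C` NO LONGER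
ASKED.**  Exactly `B13NodeTorusWalks.b13Leaf_twoTorus_walks` (p451225; same binders in the same order, same constants, same
conclusion `Lemma1Printed ∧ Lemma2Printed ∧ Lemma3Printed` for `Wt.toStepData`) except that (i) NODE A's structural input
`hA` (`((𝒦 Z t).A2 σ (uOf Z t φ)).map re ≻ 0` on the polydisc at the configuration) is REMOVED — derived inside from the
rung's accretivity and the kept complex symmetry `hAs` by `re_posDef_of_termWalks` (`‖uOf Z t φ‖ ≤ α < R`); (ii) the
per-term eigenvalue hypothesis `hcE : ∀ Z t i, spec C ≤ c_E` is REPLACED by the number `1∕q.mA ≤ c_E`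
(`eigenvalues_C_le_of_termWalks`).  What remains by assertion: the rung for Bałaban's kernels (NODE A ∕ in-edge N06),
`hAs`, `hlin`, separate holomorphy, termwise domination, `hΓq`, the in-edges (1.24)∕(1.30), identifications, numbers.
[cite: Balaban1988RG2Cluster, Lemmas 1–3 pp.9, 11, 20; p.13, p.15, (2.14)–(2.26) pp.15–17; Balaban1985BackgroundPropagators, Thm 3.10 p.416] -/
theorem b13Leaf_twoTorus_walks₂
    (Wt : TwoTorusStep 4 L N') (c : B13.Consts) (k : ℕ) (hN12 : 12 ≤ L * N') (hL8 : 8 ≤ c.L) (hLc : c.L = L)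
    -- (1) LEMMA 1: index data of (1.33)
    (S0 : TDom 4 (L * N') → Finset (TPt 4 (L * N')))
    (F : TDom 4 (L * N') → TPt 4 (L * N') → Finset (TPt 4 (L * N')))
    (Sq : TDom 4 (L * N') → TPt 4 (L * N') → (j : ℕ) → Finset (TPt 4 (L ^ (k - j) * (L * N'))))
    (SX : TDom 4 (L * N') → TPt 4 (L * N') → (j : ℕ) → TPt 4 (L ^ (k - j) * (L * N')) →
      Finset (TDom 4 (L ^ (k - j) * (L * N'))))
    (T : TDom 4 (L * N') → TPt 4 (L * N') → Finset (TPt 4 (L * N')) → (j : ℕ) →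
      TPt 4 (L ^ (k - j) * (L * N')) → TDom 4 (L ^ (k - j) * (L * N')) → Wt.Φ → ℂ)
    (Sc : TDom 4 (L * N') → Finset (TPt 4 (L * N')))
    (Sq' : TDom 4 (L * N') → TPt 4 (L * N') → (j : ℕ) → Finset (TPt 4 (L ^ (k - j) * (L * N'))))
    (SX' : TDom 4 (L * N') → TPt 4 (L * N') → (j : ℕ) → TPt 4 (L ^ (k - j) * (L * N')) →
      Finset (TDom 4 (L ^ (k - j) * (L * N'))))
    (T' : TDom 4 (L * N') → TPt 4 (L * N') → (j : ℕ) → TPt 4 (L ^ (k - j) * (L * N')) →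
      TDom 4 (L ^ (k - j) * (L * N')) → Wt.Φ → ℂ)
    (dist : TDom 4 (L * N') → TPt 4 (L * N') → (j : ℕ) → TPt 4 (L ^ (k - j) * (L * N')) → ℝ) {K K' : ℝ}
    (h133 : ∀ Y, Wt.Vp Y =
      (∑ a ∈ S0 Y, ∑ X ∈ (F Y a).powerset, ∑ j ∈ Finset.range (k + 1), ∑ q ∈ Sq Y a j,
        ∑ x ∈ SX Y a j q, T Y a X j q x) +
      (∑ a ∈ Sc Y, ∑ j ∈ Finset.range (k + 1), ∑ q ∈ Sq' Y a j, ∑ x ∈ SX' Y a j q, T' Y a j q x))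
    (hS0Y : ∀ Y, ∀ a ∈ S0 Y,
      (pbox (fun i => natLift a i - (5 : ℕ)) (fun i => natLift a i + 1 + (5 : ℕ))).image (proj (L * N')) ⊆ Y.1)
    (hFsub : ∀ Y a, F Y a ⊆
      (pbox (fun i => natLift a i - (5 : ℕ)) (fun i => natLift a i + 1 + (5 : ℕ))).image (proj (L * N')) \
        (pbox (fun i => natLift a i - (4 : ℕ)) (fun i => natLift a i + 1 + (4 : ℕ))).image (proj (L * N')))
    (hSq : ∀ Y, ∀ a ∈ S0 Y, ∀ j, Sq Y a j ⊆ (Finset.univ : Finset (TPt 4 (L ^ (k - j) * (L * N')))).filter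
      (fun q => tcoarse (L ^ (k - j)) (L * N') q ∈
        (pbox (fun i => natLift a i - (2 : ℕ)) (fun i => natLift a i + 1 + (2 : ℕ))).image (proj (L * N'))))
    (hScY : ∀ Y, Sc Y ⊆ Y.1)
    (hdist0 : ∀ Y a j q, 0 ≤ c.δ₀ * dist Y a j q)
    (hdist : ∀ Y a j (n : ℕ) q, q ∉ (pbox (fun i => ((L ^ (k - j) : ℕ) : ℤ) * natLift a i - (n + 1 : ℕ))
      (fun i => ((L ^ (k - j) : ℕ) : ℤ) * natLift a i + 2 * ((L ^ (k - j) : ℕ) : ℤ) - 1 + (n + 1 : ℕ))).image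
        (proj (L ^ (k - j) * (L * N'))) → c.δ₀ * c.M * ((n : ℝ) + 1) ≤ c.δ₀ * dist Y a j q)
    (hSX : ∀ Y a j q, SX Y a j q ⊆ (tcubeSys 4 (L ^ (k - j) * (L * N'))).above q)
    (hSX' : ∀ Y a j q, SX' Y a j q ⊆ (tcubeSys 4 (L ^ (k - j) * (L * N'))).above q)
    (hX0 : ∀ Y, ∀ a ∈ Sc Y, ∀ j ∈ Finset.range (k + 1), ∀ q ∈ Sq' Y a j, ∀ x ∈ SX' Y a j q,
      x.1.image (tcoarse (L ^ (k - j)) (L * N')) ⊆ Y.1)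
    -- (1) LEMMA 1: analyticity of the terms, closure of `Analytic`
    (hAdd : ∀ (s : Set Wt.Φ) (f g : Wt.Φ → ℂ), Wt.Analytic f s → Wt.Analytic g s → Wt.Analytic (f + g) s)
    (hZero : ∀ s : Set Wt.Φ, Wt.Analytic 0 s)
    (hAnT : ∀ Y, ∀ a ∈ S0 Y, ∀ X ∈ (F Y a).powerset, ∀ j ∈ Finset.range (k + 1), ∀ q ∈ Sq Y a j,
      ∀ x ∈ SX Y a j q, Wt.Analytic (T Y a X j q x) (Wt.sp1 Y))
    (hAnT' : ∀ Y, ∀ a ∈ Sc Y, ∀ j ∈ Finset.range (k + 1), ∀ q ∈ Sq' Y a j, ∀ x ∈ SX' Y a j q,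
      Wt.Analytic (T' Y a j q x) (Wt.sp1 Y))
    -- (1) LEMMA 1: thresholds and restrictions
    (hK : 0 ≤ K) (hK' : 0 ≤ K') (hκ : 0 ≤ c.κ) (hδ1 : c.δ < 1) (hδκ : 1 ≤ c.δ * c.κ)
    (hκ126 : kappa₀ 64 8 ≤ c.κ) (hκ126' : kappa₀ 64 8 ≤ c.δ * c.κ)
    (hκ₁ : 1 + 2 * Real.log (8 * 12 ^ 3) ≤ c.κ₁) (hκ₁' : 2 + 16 * Real.log 128 ≤ c.κ₁)
    (hδ₀M : 10 * Real.exp (-1) ≤ c.δ₀ * c.M) (hδ₀M5 : 2 * Real.log 5 ≤ c.δ₀ * c.M)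
    (hR8 : (1 - c.δ) * c.κ ≤ (1 / 4) * (c.κ₁ - 1)) (hR9 : (1 - 2 * c.δ) * c.κ ≤ (1 / 16) * c.κ₁)
    -- (1) LEMMA 1: per-term (1.24), (1.30) (IN-EDGES); the constants of (1.36) with headroom (1 − θ) for the local pieces
    (h124 : ∀ Y φ, φ ∈ Wt.sp1 Y → ∀ a ∈ S0 Y, ∀ X ∈ (F Y a).powerset, ∀ j ∈ Finset.range (k + 1), ∀ q ∈ Sq Y a j,
      ∀ x ∈ SX Y a j q,
        ‖T Y a X j q x φ‖ ≤ K * ((L : ℝ) ^ j * ((L : ℝ) ^ k)⁻¹) ^ 5 *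
          Real.exp (-(c.κ₁ - 1) *
            (((Y.1 \ (pbox (fun i => natLift a i - (5 : ℕ)) (fun i => natLift a i + 1 + (5 : ℕ))).image
              (proj (L * N'))).card : ℝ) + X.card)) *
          Real.exp (-(c.κ * torusTreeLen x.1)))
    (h130 : ∀ Y φ, φ ∈ Wt.sp1 Y → ∀ a ∈ Sc Y, ∀ j ∈ Finset.range (k + 1), ∀ q ∈ Sq' Y a j,
      ∀ x ∈ SX' Y a j q,
        ‖T' Y a j q x φ‖ ≤ K' * Real.exp (-(1 / 2) * (c.δ₀ * c.M) * ((L : ℝ) ^ j * ((L : ℝ) ^ k)⁻¹)⁻¹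
            - (1 / 2) * c.δ₀ * dist Y a j q) *
          Real.exp (-(c.κ₁ - 1) * ((Y.1 \ x.1.image (tcoarse (L ^ (k - j)) (L * N'))).card : ℝ)) *
          Real.exp (-(c.κ * torusTreeLen x.1)))
    {θ : ℝ} (hθ0 : 0 ≤ θ) (hθ1 : θ < 1)
    (hC : K * K₀ 64 8 * (2 * (6 * (L : ℝ)) ^ 4) * Real.exp 1 * Real.exp ((1 / 8) * c.κ₁ * (12 ^ 4 - 1)) +
        2 * (64 * K') * K₀ 64 8 * 1344 ≤
      (1 - θ) * (c.E₀ * c.ε₁ * c.C₁ * c.M ^ c.q * Real.exp (c.C₂ * c.κ₁)))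
    -- (2) LEMMA 2 (pp. 10–11): V″_k = V′_k + the local pieces G of P^{(k)}, analytic and (1.36)-small at prefactor θ
    (Gl : TDom 4 (L * N') → Wt.Φ → ℂ) (hVpp : ∀ Y, Wt.Vpp Y = fun φ => Wt.Vp Y φ + Gl Y φ)
    (hGlAn : ∀ Y, Wt.Analytic (Gl Y) (Wt.sp1 Y))
    (hGl : ∀ Y φ, φ ∈ Wt.sp1 Y → ‖Gl Y φ‖ ≤ θ * (c.E₀ * c.ε₁ * c.C₁ * c.M ^ c.q * Real.exp (c.C₂ * c.κ₁)) *
      Real.exp (-((1 - 2 * c.δ) * c.κ * (tsys 4 (L * N')).dj Y)))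
    -- (2) LEMMA 2: the located per-term data of `B13Lemma2Torus.lemma2Printed_twoTorus'`
    {E : Type*} [NormedAddCommGroup E] [NormedSpace ℂ E]
    (rd : TDom 4 (L * N') → Wt.Φ → E) (e : TDom 4 (L * N') → Wt.Bond → E) (he : ∀ Y b, ‖e Y b‖ ≤ 1)
    (hrd : ∀ Y φ, rd Y φ = haveI := Wt.finBond; ∑ b, Wt.Bv φ b • e Y b)
    {ι₂ : Type*} (s : TDom 4 (L * N') → Finset ι₂) (Wf : TDom 4 (L * N') → ι₂ → Wt.Φ → E → ℂ) {g : ℂ} (hg : g ≠ 0)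
    {R K₂ : ℝ} {m₂ : ℕ} (hK₂ : 0 ≤ K₂) (hR : 0 < R) (h3 : 3 * c.ε₁ ≤ R)
    (hW : ∀ Y, ∀ i ∈ s Y, ∀ φ ∈ Wt.sp1 Y, AnalyticOnNhd ℂ (Wf Y i φ) (ball 0 R))
    (hKW : ∀ Y, ∀ i ∈ s Y, ∀ φ ∈ Wt.sp1 Y, ∀ z ∈ ball (0 : E) R,
      ‖Wf Y i φ z‖ ≤ K₂ * Real.exp (-(c.κ₁ - 1) * ((Y.1.card : ℝ) - 1)) * ‖z‖ ^ 3)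
    (hcard : ∀ Y, (s Y).card ≤ m₂ * Y.1.card)
    (hV : ∀ Y, Wt.V Y = fun φ => (∑ i ∈ s Y, scaled g (Wf Y i φ) (rd Y φ)) + Wt.Vpp Y φ)
    (hQ : ∀ Y φ (b b' : Wt.Bond), φ ∈ Wt.sp1 Y →
      Wt.Q Y φ b b' = 2 * ∑ i ∈ s Y, Qop (scaled g (Wf Y i φ)) (rd Y φ) (e Y b) (e Y b'))
    (hsp : ∀ Y φ, φ ∈ Wt.sp1 Y → ‖g‖ * ‖rd Y φ‖ < c.ε₁)
    (hvolk : ∀ Y, Wt.volk Y = Y.1.card)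
    (hfloor : 27 * m₂ * K₂ * Real.exp (c.κ₁ - 1) ≤ c.C₃ * c.M ^ 4 * Real.exp (c.C₂ * c.κ₁))
    (hAnP : ∀ Y, ∀ i ∈ s Y, Wt.Analytic (fun φ => scaled g (Wf Y i φ) (rd Y φ)) (Wt.sp1 Y))
    (hG : ∀ Y, Wt.GaugeInv (Wt.V Y) ∧ Wt.GaugeInv (Wt.toStepData.quadForm Y) ∧ Wt.GaugeInv (Wt.Vpp Y))
    -- (3) LEMMA 3 (pp. 14–20): the signs of (2.18)–(2.20), R12, |τ(Y)| ≥ 2, and the numerics bundle at ℓ = ½L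
    (M₃ : ℕ) [NeZero M₃] {a a₂ a₂' a₅ Aabs : ℝ} (hN : Lemma3Numerics c M₃ ((c.L : ℝ) / 2) a a₂ a₂' a₅ Aabs)
    (h12 : R12 c) (hE : 0 < c.E₀) (hε : 0 < c.ε₁) (hC₁ : 0 < c.C₁) (hα : 0 < c.α₄) (hM : 1 ≤ c.M)
    (hτ2 : c.E₀ * c.ε₁ * c.C₁ * c.α₄⁻¹ * c.M ^ c.q * Real.exp (c.C₂ * c.κ₁) ≤ 1 / 2)
    -- (3) the Cauchy radius and the parameter domains (p. 15)
    {Uσ Uτ : Set ℂ} (hUσ : IsOpen Uσ) (hUτ : IsOpen Uτ) (hUexp : Metric.closedBall (0 : ℂ) (Real.exp c.κ₁) ⊆ Uσ)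
    (hUtau : ∀ Y : TDom 4 (L * N'), Metric.closedBall (0 : ℂ) ((invTau c ((tsys 4 (L * N')).dj Y))⁻¹) ⊆ Uτ)
    {r : ℝ} (hr : 0 < r) (hr' : r ≤ Real.exp c.κ₁ - 1)
    (hsubτ : ∀ x ∈ Set.uIcc (0 : ℝ) 1, Metric.closedBall (x : ℂ) r ⊆ Uτ)
    -- (3) THE DICTIONARY: per term (𝐃, P) of every Z ∈ 𝐃_{k+1}, the kernel data `𝒦 Z t` on a site torus `UT Nf` with
    --     configuration space `E₃`, and the configuration `u = uOf Z t φ` of `φ ∈ sp2 Z`, of size ≤ α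
    {ν : ℕ} {Nf : Fin ν → ℕ} [∀ i, NeZero (Nf i)]
    {E₃ : Type*} [NormedAddCommGroup E₃] [NormedSpace ℂ E₃]
    (𝒦 : TDom 4 N' → Finset (TDom 4 (L * N')) × Finset (TBond 4 M₃ (L * N')) → TermKernels c 4 N' ν Nf E₃)
    [∀ Z t, Fintype (𝒦 Z t).C₀] [∀ Z t, DecidableEq (𝒦 Z t).C₀]
    (uOf : (Z : TDom 4 N') → (t : Finset (TDom 4 (L * N')) × Finset (TBond 4 M₃ (L * N'))) → Wt.Φ → E₃)
    {α : ℝ} (hαnn : 0 ≤ α) (huα : ∀ Z, ∀ t ∈ terms L M₃ Z, ∀ φ ∈ Wt.sp2 Z, ‖uOf Z t φ‖ ≤ α)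
    -- (3) per term: parameter lists, the linear map Γ(σ), characteristic functions, potentials
    (lZ : TDom 4 N' → Finset (TDom 4 (L * N')) × Finset (TBond 4 M₃ (L * N')) → List (TPt 4 N'))
    (hlZ : ∀ Z, ∀ t ∈ terms L M₃ Z, (lZ Z t).Nodup ∧ (lZ Z t).toFinset = Z.1 \ tclosure L N' (Z0 M₃ t))
    (lD : TDom 4 N' → Finset (TDom 4 (L * N')) × Finset (TBond 4 M₃ (L * N')) → List (TDom 4 (L * N')))
    (hlD : ∀ Z, ∀ t ∈ terms L M₃ Z, (lD Z t).Nodup ∧ (lD Z t).toFinset = t.1)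
    (Γm : (Z : TDom 4 N') → (t : Finset (TDom 4 (L * N')) × Finset (TBond 4 M₃ (L * N'))) → Wt.Φ →
      (TPt 4 N' → ℂ) → ((𝒦 Z t).Λ ⊕ (𝒦 Z t).C₀ → ℝ) → ((𝒦 Z t).Λ → ℂ))
    (χY₀ χcP : (Z : TDom 4 N') → (t : Finset (TDom 4 (L * N')) × Finset (TBond 4 M₃ (L * N'))) →
      ((𝒦 Z t).Λ → ℝ) → ℝ)
    (hχ0 : ∀ Z t B, 0 ≤ χY₀ Z t B) (hχ1 : ∀ Z t B, χY₀ Z t B ≤ 1)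
    (Pl : (Z : TDom 4 N') → (t : Finset (TDom 4 (L * N')) × Finset (TBond 4 M₃ (L * N'))) → Finset (𝒦 Z t).Λ)
    (hPcard : ∀ Z, ∀ t ∈ terms L M₃ Z, (Pl Z t).card = t.2.card) {rP : ℝ} (hrP : 0 ≤ rP)
    (hχc : ∀ Z t B, χcP Z t B = ∏ b ∈ Pl Z t, (if rP ≤ |B b| then (1 : ℝ) else 0))
    (Dfam : TDom 4 N' → Finset (TDom 4 (L * N')) × Finset (TBond 4 M₃ (L * N')) → Finset (TDom 4 (L * N')))
    (Vr : (Z : TDom 4 N') → (t : Finset (TDom 4 (L * N')) × Finset (TBond 4 M₃ (L * N'))) → Wt.Φ →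
      TDom 4 (L * N') → ((𝒦 Z t).Λ → ℝ) → ℂ)
    -- (3) termwise domination: ‖H(Z)‖ ≤ Σ_{(𝐃,P)} ‖(2.14)‖ on the space of p. 15 ((2.9)/(2.14))
    (hH : ∀ (Z : TDom 4 N') (φ : Wt.Φ), φ ∈ Wt.sp2 Z → ‖Wt.H Z φ‖ ≤
      ∑ t ∈ terms L M₃ Z, ‖term214 r (lZ Z t) (lD Z t)
        (core214 (fun σ => (𝒦 Z t).A2 σ (uOf Z t φ)) (Γm Z t φ)
          (F214 t.2.card (χY₀ Z t) (χcP Z t) (Dfam Z t) (Vr Z t φ))) 0 0‖)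
    -- (3) the record's objects behind the terms: bonds, cubes, the real field inside the configurations
    (ιb : (Z : TDom 4 N') → (t : Finset (TDom 4 (L * N')) × Finset (TBond 4 M₃ (L * N'))) → (𝒦 Z t).Λ → Wt.Bond)
    (hι : ∀ Z t, Function.Injective (ιb Z t)) (cube : Wt.Bond → TPt 4 (L * N'))
    (hQsupp : ∀ (Y : TDom 4 (L * N')) φ b b', Wt.Q Y φ b b' ≠ 0 → cube b ∈ Y.1 ∧ cube b' ∈ Y.1)
    {m' : ℕ} (hfibc : ∀ Z t (x : TPt 4 (L * N')), (Finset.univ.filter fun j => cube (ιb Z t j) = x).card ≤ m')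
    (emb : (Z : TDom 4 N') → (t : Finset (TDom 4 (L * N')) × Finset (TBond 4 M₃ (L * N'))) → Wt.Φ →
      ((𝒦 Z t).Λ → ℝ) → Wt.Φ)
    (hBv : ∀ Z t φ B b, Wt.Bv (emb Z t φ B) (ιb Z t b) = (B b : ℂ))
    (hBv0 : ∀ Z t φ B b', b' ∉ Set.range (ιb Z t) → Wt.Bv (emb Z t φ B) b' = 0)
    (hVr : ∀ Z, ∀ t ∈ terms L M₃ Z, ∀ φ ∈ Wt.sp2 Z, ∀ Y ∈ Dfam Z t, ∀ B,
      emb Z t φ B ∈ Wt.sp1 Y → Vr Z t φ Y B = Wt.V Y (emb Z t φ B))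
    (hχsupp : ∀ Z, ∀ t ∈ terms L M₃ Z, ∀ φ ∈ Wt.sp2 Z, ∀ B, χY₀ Z t B ≠ 0 → ∀ Y ∈ Dfam Z t,
      emb Z t φ B ∈ Wt.sp1 Y)
    -- (3) separate holomorphy of the X-integral in (σ, τ)
    (hΨσ : ∀ Z, ∀ t ∈ terms L M₃ Z, ∀ φ ∈ Wt.sp2 Z, ∀ τ : TDom 4 (L * N') → ℂ, (∀ j, τ j ∈ Uτ) →
      SepHolOn Uσ (fun σ => core214 (fun σ => (𝒦 Z t).A2 σ (uOf Z t φ)) (Γm Z t φ)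
        (F214 t.2.card (χY₀ Z t) (χcP Z t) (Dfam Z t) (Vr Z t φ)) σ τ))
    (hΨτ : ∀ Z, ∀ t ∈ terms L M₃ Z, ∀ φ ∈ Wt.sp2 Z, ∀ σ : TPt 4 N' → ℂ, (∀ j, σ j ∈ Uσ) →
      SepHolOn Uτ (fun τ => core214 (fun σ => (𝒦 Z t).A2 σ (uOf Z t φ)) (Γm Z t φ)
        (F214 t.2.card (χY₀ Z t) (χcP Z t) (Dfam Z t) (Vr Z t φ)) σ τ))
    -- (3) NODE A's structural inputs at the configuration: A(σ) COMPLEX SYMMETRIC on the polydisc; Γ(σ) = G(σ)·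
    --     (`Re A(σ) ≻ 0` is no longer asked: it follows from the rung's m_A-accretivity, `re_posDef_of_termWalks`)
    (hAs : ∀ Z, ∀ t ∈ terms L M₃ Z, ∀ φ ∈ Wt.sp2 Z, ∀ σ : TPt 4 N' → ℂ, (∀ j, ‖σ j‖ ≤ Real.exp c.κ₁) →
      ((𝒦 Z t).A2 σ (uOf Z t φ)).IsSymm)
    (hlin : ∀ Z, ∀ t ∈ terms L M₃ Z, ∀ φ ∈ Wt.sp2 Z, ∀ σ : TPt 4 N' → ℂ, (∀ j, ‖σ j‖ ≤ Real.exp c.κ₁) →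
      ∀ X : (𝒦 Z t).Λ ⊕ (𝒦 Z t).C₀ → ℝ, Γm Z t φ σ X = (𝒦 Z t).G2 σ (uOf Z t φ) *ᵥ fun j => (X j : ℂ))
    {γ₂ : ℝ} (hγ₂ : 0 ≤ γ₂)
    -- (3) uniform fibre bounds of the bond locations
    {m : ℕ}
    (hfibΛ : ∀ Z t (x : UT Nf), (Finset.univ.filter fun i => (𝒦 Z t).locΛ i = x).card ≤ m)
    (hfibN : ∀ Z t (x : UT Nf), (Finset.univ.filter fun j => (𝒦 Z t).locN j = x).card ≤ m)
    -- (3) THE W-WALKS RUNG ON THE TERMS OF THE STEP (the displayed hypothesis): ONE package, a rate book, round letters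
    (q : WalkPackage) (hq : q.Admissible) (rb : RateBook q) (hκC : 0 < rb.κC) (hκCρ : rb.κC ≤ rb.ρ') (hαR : α < q.R)
    (hwalks : ∀ Z, ∀ t ∈ terms L M₃ Z, TermWalks (𝒦 Z t) q)
    {KG KCs θ₀ : ℝ} (hKG : q.Kbar ≤ KG) (hKCs : 4 / q.mA ≤ KCs)
    (hθ : 2 * q.Kbar * (Real.exp (-((rb.ρ' - rb.κC) * q.Rσ)) + α / q.R) ≤ θ₀)
    -- (3) rates below the rung's κ_C, and NODE A's letter ϑ (θ_Γ = θ_E = θ₀, K_Γ = K_G, K₀′ = K_Cs, θ_C derived)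
    {kap kap' kap'' kap₂ ϑ : ℝ} (hkap'' : 0 < kap'') (hk1 : kap'' < kap') (hk2 : kap' < kap) (hk3 : kap < kap₂)
    (hk4 : kap₂ < rb.κC) (hθ₀le : θ₀ ≤ ϑ)
    (hθR1le : (m * (1 + 2 / (kap - kap')) ^ ν) * (m * (1 + 2 / (kap' - kap'')) ^ ν)
      * (θ₀ * KCs * KG
        + KG * (KCs * θ₀ * (m * (1 + 2 / (rb.κC - kap₂)) ^ ν) * KCs * (m * (1 + 2 / (kap₂ - kap)) ^ ν)) * KG
        + KG * KCs * θ₀) ≤ ϑ)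
    (hsmallKθ : KCs * (m * (1 + 2 / kap) ^ ν) * (ϑ * (m * (1 + 2 / kap'') ^ ν)) < 1)
    -- (3) the (2.24)–(2.25) smallness with `a₂₀ = m′·α₄·M⁻⁴(1 + 32/(κ₁−1))⁴`; the eigenvalue bound of C is the NUMBER
    --     `1∕m_A ≤ cE` (`eigenvalues_C_le_of_termWalks`); the form bound of Γ₀
    {cE gq : ℝ} (hc0 : 0 ≤ cE)
    (hcE : 1 / q.mA ≤ cE)
    (hαc : (2 * (ϑ * (m * (1 + 2 / kap'') ^ ν)) +
      (γ₂ + m' * c.α₄ * (c.M ^ 4)⁻¹ * (1 + 32 / (c.κ₁ - 1)) ^ 4)) * cE ≤ 1 / 2) (hgq : 0 ≤ gq)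
    (hΓq : ∀ Z, ∀ t ∈ terms L M₃ Z, ∀ X : (𝒦 Z t).Λ ⊕ (𝒦 Z t).C₀ → ℝ,
      ((𝒦 Z t).Γ₀ *ᵥ X) ⬝ᵥ ((𝒦 Z t).C *ᵥ ((𝒦 Z t).Γ₀ *ᵥ X)) ≤ gq * (X ⬝ᵥ X))
    (hsmall : (2 * (ϑ * (m * (1 + 2 / kap'') ^ ν)) +
      (γ₂ + m' * c.α₄ * (c.M ^ 4)⁻¹ * (1 + 32 / (c.κ₁ - 1)) ^ 4)) * (1 + 2 * cE * gq) ≤ 1 / 2)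
    -- (3) constant matching, p. 17: `a ≤ γ₂ r_P²` and the volume factor with `w = K₀(64,8)·α₄·#(⋃𝐃)`
    (hPa : a ≤ γ₂ * rP ^ 2)
    (hvol : ∀ Z, ∀ t ∈ terms L M₃ Z,
      2 * (KCs * (m * (1 + 2 / kap) ^ ν) * (ϑ * (m * (1 + 2 / kap'') ^ ν))
              * (1 + (1 - KCs * (m * (1 + 2 / kap) ^ ν) * (ϑ * (m * (1 + 2 / kap'') ^ ν)))⁻¹) / 2)
          * (Fintype.card (𝒦 Z t).Λ : ℝ)
        + K₀ 64 8 * c.α₄ * ((((Dfam Z t).image Subtype.val).biUnion id).card : ℝ)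
        + (2 * (ϑ * (m * (1 + 2 / kap'') ^ ν)) +
            (γ₂ + m' * c.α₄ * (c.M ^ 4)⁻¹ * (1 + 32 / (c.κ₁ - 1)) ^ 4)) * cE * (Fintype.card (𝒦 Z t).Λ : ℝ)
        + (2 * (ϑ * (m * (1 + 2 / kap'') ^ ν)) +
            (γ₂ + m' * c.α₄ * (c.M ^ 4)⁻¹ * (1 + 32 / (c.κ₁ - 1)) ^ 4)) * (1 + 2 * cE * gq)
            * (Fintype.card ((𝒦 Z t).Λ ⊕ (𝒦 Z t).C₀) : ℝ)
        ≤ a₅ * ((Z.1).card : ℝ)) :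
    B13.Lemma1Printed Wt.toStepData c ∧ B13.Lemma2Printed Wt.toStepData c ∧ B13.Lemma3Printed Wt.toStepData c := by
  -- NODE A's `hA` and the eigenvalue bound of `C`, from the rung's accretivity
  have hA : ∀ Z, ∀ t ∈ terms L M₃ Z, ∀ φ ∈ Wt.sp2 Z, ∀ σ : TPt 4 N' → ℂ, (∀ j, ‖σ j‖ ≤ Real.exp c.κ₁) →
      (((𝒦 Z t).A2 σ (uOf Z t φ)).map Complex.re).PosDef := fun Z t ht φ hφ σ hσ =>
    re_posDef_of_termWalks hq (hwalks Z t ht) ((huα Z t ht φ hφ).trans_lt hαR) σ hσ (hAs Z t ht φ hφ σ hσ)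
  have hcE' : ∀ Z, ∀ t ∈ terms L M₃ Z, ∀ i, (𝒦 Z t).hC.1.eigenvalues i ≤ cE := fun Z t ht i =>
    (eigenvalues_C_le_of_termWalks hq (hwalks Z t ht) i).trans hcE
  exact b13Leaf_twoTorus_walks Wt c k hN12 hL8 hLc S0 F Sq SX T Sc Sq' SX' T' dist h133 hS0Y hFsub hSq hScY hdist0
    hdist hSX hSX' hX0 hAdd hZero hAnT hAnT' hK hK' hκ hδ1 hδκ hκ126 hκ126' hκ₁ hκ₁' hδ₀M hδ₀M5 hR8 hR9 h124 h130
    hθ0 hθ1 hC Gl hVpp hGlAn hGl rd e he hrd s Wf hg hK₂ hR h3 hW hKW hcard hV hQ hsp hvolk hfloor hAnP hG M₃ hN h12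
    hE hε hC₁ hα hM hτ2 hUσ hUτ hUexp hUtau hr hr' hsubτ 𝒦 uOf hαnn huα lZ hlZ lD hlD Γm χY₀ χcP hχ0 hχ1 Pl hPcard
    hrP hχc Dfam Vr hH ιb hι cube hQsupp hfibc emb hBv hBv0 hVr hχsupp hΨσ hΨτ hAs hA hlin hγ₂ hfibΛ hfibN q hq rb
    hκC hκCρ hαR hwalks hKG hKCs hθ hkap'' hk1 hk2 hk3 hk4 hθ₀le hθR1le hsmallKθ hc0 hcE' hαc hgq hΓq hsmall hPa hvol

end Walks

/-! ## §3. The FAN-OUT s3 shape WITHOUT `hA` and with `c_E` a number -/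

section Across

variable {L : ℕ} [NeZero L]

open Matrix

open Classical in
/-- **N10's LEAF TRIPLE FROM THE DISPLAYED HYPOTHESIS `UniformWalksAcross 𝓣 q` — `Re A ≻ 0` AND THE SPECTRUM OF `C` NO
LONGER ASKED.**  Exactly `B13NodeTorusWalks.b13Leaf_twoTorus_uniformWalksAcross` (p451225; the family `𝓣 : S → TorusTerms
c 4` carrying the rung with ONE package, admissible with positive rates and `η ≤ etaMax`, the member `s₀` listing the
step's terms, print's two thresholds for a `θ₀ > 0`, and the binders of the walks leaf) except that `hA` is REMOVED
(from accretivity and `hAs`, `re_posDef_of_termWalks`) and `hcE` is the number `1∕q.mA ≤ c_E`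
(`eigenvalues_C_le_of_termWalks`).  N10's leaf CLOSED MODULO NODE A's ONE Prop with one structural input fewer;
count-neutral; N10 NOT discharged.
[cite: Balaban1988RG2Cluster, Lemmas 1–3 pp.9, 11, 20; (1.11) p.5, p.13, p.15, (2.14)–(2.26) pp.15–17; Balaban1985BackgroundPropagators, Thm 3.10 p.416] -/
theorem b13Leaf_twoTorus_uniformWalksAcross₂
    (c : B13.Consts) {S : Type*} (𝓣 : S → TorusTerms c 4) {q : WalkPackage} (hall : UniformWalksAcross 𝓣 q)
    (s₀ : S) [NeZero (𝓣 s₀).N'] (Wt : TwoTorusStep 4 L (𝓣 s₀).N') (k : ℕ) (hN12 : 12 ≤ L * (𝓣 s₀).N') (hL8 : 8 ≤ c.L) (hLc : c.L = L)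
    -- (1) LEMMA 1: index data of (1.33)
    (S0 : TDom 4 (L * (𝓣 s₀).N') → Finset (TPt 4 (L * (𝓣 s₀).N')))
    (F : TDom 4 (L * (𝓣 s₀).N') → TPt 4 (L * (𝓣 s₀).N') → Finset (TPt 4 (L * (𝓣 s₀).N')))
    (Sq : TDom 4 (L * (𝓣 s₀).N') → TPt 4 (L * (𝓣 s₀).N') → (j : ℕ) → Finset (TPt 4 (L ^ (k - j) * (L * (𝓣 s₀).N'))))
    (SX : TDom 4 (L * (𝓣 s₀).N') → TPt 4 (L * (𝓣 s₀).N') → (j : ℕ) → TPt 4 (L ^ (k - j) * (L * (𝓣 s₀).N')) →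
      Finset (TDom 4 (L ^ (k - j) * (L * (𝓣 s₀).N'))))
    (T : TDom 4 (L * (𝓣 s₀).N') → TPt 4 (L * (𝓣 s₀).N') → Finset (TPt 4 (L * (𝓣 s₀).N')) → (j : ℕ) →
      TPt 4 (L ^ (k - j) * (L * (𝓣 s₀).N')) → TDom 4 (L ^ (k - j) * (L * (𝓣 s₀).N')) → Wt.Φ → ℂ)
    (Sc : TDom 4 (L * (𝓣 s₀).N') → Finset (TPt 4 (L * (𝓣 s₀).N')))
    (Sq' : TDom 4 (L * (𝓣 s₀).N') → TPt 4 (L * (𝓣 s₀).N') → (j : ℕ) → Finset (TPt 4 (L ^ (k - j) * (L * (𝓣 s₀).N'))))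
    (SX' : TDom 4 (L * (𝓣 s₀).N') → TPt 4 (L * (𝓣 s₀).N') → (j : ℕ) → TPt 4 (L ^ (k - j) * (L * (𝓣 s₀).N')) →
      Finset (TDom 4 (L ^ (k - j) * (L * (𝓣 s₀).N'))))
    (T' : TDom 4 (L * (𝓣 s₀).N') → TPt 4 (L * (𝓣 s₀).N') → (j : ℕ) → TPt 4 (L ^ (k - j) * (L * (𝓣 s₀).N')) →
      TDom 4 (L ^ (k - j) * (L * (𝓣 s₀).N')) → Wt.Φ → ℂ)
    (dist : TDom 4 (L * (𝓣 s₀).N') → TPt 4 (L * (𝓣 s₀).N') → (j : ℕ) → TPt 4 (L ^ (k - j) * (L * (𝓣 s₀).N')) → ℝ) {K K' : ℝ}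
    (h133 : ∀ Y, Wt.Vp Y =
      (∑ a ∈ S0 Y, ∑ X ∈ (F Y a).powerset, ∑ j ∈ Finset.range (k + 1), ∑ q ∈ Sq Y a j,
        ∑ x ∈ SX Y a j q, T Y a X j q x) +
      (∑ a ∈ Sc Y, ∑ j ∈ Finset.range (k + 1), ∑ q ∈ Sq' Y a j, ∑ x ∈ SX' Y a j q, T' Y a j q x))
    (hS0Y : ∀ Y, ∀ a ∈ S0 Y,
      (pbox (fun i => natLift a i - (5 : ℕ)) (fun i => natLift a i + 1 + (5 : ℕ))).image (proj (L * (𝓣 s₀).N')) ⊆ Y.1)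
    (hFsub : ∀ Y a, F Y a ⊆
      (pbox (fun i => natLift a i - (5 : ℕ)) (fun i => natLift a i + 1 + (5 : ℕ))).image (proj (L * (𝓣 s₀).N')) \
        (pbox (fun i => natLift a i - (4 : ℕ)) (fun i => natLift a i + 1 + (4 : ℕ))).image (proj (L * (𝓣 s₀).N')))
    (hSq : ∀ Y, ∀ a ∈ S0 Y, ∀ j, Sq Y a j ⊆ (Finset.univ : Finset (TPt 4 (L ^ (k - j) * (L * (𝓣 s₀).N')))).filter
      (fun q => tcoarse (L ^ (k - j)) (L * (𝓣 s₀).N') q ∈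
        (pbox (fun i => natLift a i - (2 : ℕ)) (fun i => natLift a i + 1 + (2 : ℕ))).image (proj (L * (𝓣 s₀).N'))))
    (hScY : ∀ Y, Sc Y ⊆ Y.1)
    (hdist0 : ∀ Y a j q, 0 ≤ c.δ₀ * dist Y a j q)
    (hdist : ∀ Y a j (n : ℕ) q, q ∉ (pbox (fun i => ((L ^ (k - j) : ℕ) : ℤ) * natLift a i - (n + 1 : ℕ))
      (fun i => ((L ^ (k - j) : ℕ) : ℤ) * natLift a i + 2 * ((L ^ (k - j) : ℕ) : ℤ) - 1 + (n + 1 : ℕ))).image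
        (proj (L ^ (k - j) * (L * (𝓣 s₀).N'))) → c.δ₀ * c.M * ((n : ℝ) + 1) ≤ c.δ₀ * dist Y a j q)
    (hSX : ∀ Y a j q, SX Y a j q ⊆ (tcubeSys 4 (L ^ (k - j) * (L * (𝓣 s₀).N'))).above q)
    (hSX' : ∀ Y a j q, SX' Y a j q ⊆ (tcubeSys 4 (L ^ (k - j) * (L * (𝓣 s₀).N'))).above q)
    (hX0 : ∀ Y, ∀ a ∈ Sc Y, ∀ j ∈ Finset.range (k + 1), ∀ q ∈ Sq' Y a j, ∀ x ∈ SX' Y a j q,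
      x.1.image (tcoarse (L ^ (k - j)) (L * (𝓣 s₀).N')) ⊆ Y.1)
    -- (1) LEMMA 1: analyticity of the terms, closure of `Analytic`
    (hAdd : ∀ (s : Set Wt.Φ) (f g : Wt.Φ → ℂ), Wt.Analytic f s → Wt.Analytic g s → Wt.Analytic (f + g) s)
    (hZero : ∀ s : Set Wt.Φ, Wt.Analytic 0 s)
    (hAnT : ∀ Y, ∀ a ∈ S0 Y, ∀ X ∈ (F Y a).powerset, ∀ j ∈ Finset.range (k + 1), ∀ q ∈ Sq Y a j,
      ∀ x ∈ SX Y a j q, Wt.Analytic (T Y a X j q x) (Wt.sp1 Y))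
    (hAnT' : ∀ Y, ∀ a ∈ Sc Y, ∀ j ∈ Finset.range (k + 1), ∀ q ∈ Sq' Y a j, ∀ x ∈ SX' Y a j q,
      Wt.Analytic (T' Y a j q x) (Wt.sp1 Y))
    -- (1) LEMMA 1: thresholds and restrictions
    (hK : 0 ≤ K) (hK' : 0 ≤ K') (hκ : 0 ≤ c.κ) (hδ1 : c.δ < 1) (hδκ : 1 ≤ c.δ * c.κ)
    (hκ126 : kappa₀ 64 8 ≤ c.κ) (hκ126' : kappa₀ 64 8 ≤ c.δ * c.κ)
    (hκ₁ : 1 + 2 * Real.log (8 * 12 ^ 3) ≤ c.κ₁) (hκ₁' : 2 + 16 * Real.log 128 ≤ c.κ₁)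
    (hδ₀M : 10 * Real.exp (-1) ≤ c.δ₀ * c.M) (hδ₀M5 : 2 * Real.log 5 ≤ c.δ₀ * c.M)
    (hR8 : (1 - c.δ) * c.κ ≤ (1 / 4) * (c.κ₁ - 1)) (hR9 : (1 - 2 * c.δ) * c.κ ≤ (1 / 16) * c.κ₁)
    -- (1) LEMMA 1: per-term (1.24), (1.30) (IN-EDGES); the constants of (1.36) with headroom (1 − θ) for the local pieces
    (h124 : ∀ Y φ, φ ∈ Wt.sp1 Y → ∀ a ∈ S0 Y, ∀ X ∈ (F Y a).powerset, ∀ j ∈ Finset.range (k + 1), ∀ q ∈ Sq Y a j,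
      ∀ x ∈ SX Y a j q,
        ‖T Y a X j q x φ‖ ≤ K * ((L : ℝ) ^ j * ((L : ℝ) ^ k)⁻¹) ^ 5 *
          Real.exp (-(c.κ₁ - 1) *
            (((Y.1 \ (pbox (fun i => natLift a i - (5 : ℕ)) (fun i => natLift a i + 1 + (5 : ℕ))).image
              (proj (L * (𝓣 s₀).N'))).card : ℝ) + X.card)) *
          Real.exp (-(c.κ * torusTreeLen x.1)))
    (h130 : ∀ Y φ, φ ∈ Wt.sp1 Y → ∀ a ∈ Sc Y, ∀ j ∈ Finset.range (k + 1), ∀ q ∈ Sq' Y a j,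
      ∀ x ∈ SX' Y a j q,
        ‖T' Y a j q x φ‖ ≤ K' * Real.exp (-(1 / 2) * (c.δ₀ * c.M) * ((L : ℝ) ^ j * ((L : ℝ) ^ k)⁻¹)⁻¹
            - (1 / 2) * c.δ₀ * dist Y a j q) *
          Real.exp (-(c.κ₁ - 1) * ((Y.1 \ x.1.image (tcoarse (L ^ (k - j)) (L * (𝓣 s₀).N'))).card : ℝ)) *
          Real.exp (-(c.κ * torusTreeLen x.1)))
    {θ : ℝ} (hθ0 : 0 ≤ θ) (hθ1 : θ < 1)
    (hC : K * K₀ 64 8 * (2 * (6 * (L : ℝ)) ^ 4) * Real.exp 1 * Real.exp ((1 / 8) * c.κ₁ * (12 ^ 4 - 1)) +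
        2 * (64 * K') * K₀ 64 8 * 1344 ≤
      (1 - θ) * (c.E₀ * c.ε₁ * c.C₁ * c.M ^ c.q * Real.exp (c.C₂ * c.κ₁)))
    -- (2) LEMMA 2 (pp. 10–11): V″_k = V′_k + the local pieces G of P^{(k)}, analytic and (1.36)-small at prefactor θ
    (Gl : TDom 4 (L * (𝓣 s₀).N') → Wt.Φ → ℂ) (hVpp : ∀ Y, Wt.Vpp Y = fun φ => Wt.Vp Y φ + Gl Y φ)
    (hGlAn : ∀ Y, Wt.Analytic (Gl Y) (Wt.sp1 Y))
    (hGl : ∀ Y φ, φ ∈ Wt.sp1 Y → ‖Gl Y φ‖ ≤ θ * (c.E₀ * c.ε₁ * c.C₁ * c.M ^ c.q * Real.exp (c.C₂ * c.κ₁)) *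
      Real.exp (-((1 - 2 * c.δ) * c.κ * (tsys 4 (L * (𝓣 s₀).N')).dj Y)))
    -- (2) LEMMA 2: the located per-term data of `B13Lemma2Torus.lemma2Printed_twoTorus'`
    {E : Type*} [NormedAddCommGroup E] [NormedSpace ℂ E]
    (rd : TDom 4 (L * (𝓣 s₀).N') → Wt.Φ → E) (e : TDom 4 (L * (𝓣 s₀).N') → Wt.Bond → E) (he : ∀ Y b, ‖e Y b‖ ≤ 1)
    (hrd : ∀ Y φ, rd Y φ = haveI := Wt.finBond; ∑ b, Wt.Bv φ b • e Y b)
    {ι₂ : Type*} (s : TDom 4 (L * (𝓣 s₀).N') → Finset ι₂) (Wf : TDom 4 (L * (𝓣 s₀).N') → ι₂ → Wt.Φ → E → ℂ) {g : ℂ} (hg : g ≠ 0)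
    {R K₂ : ℝ} {m₂ : ℕ} (hK₂ : 0 ≤ K₂) (hR : 0 < R) (h3 : 3 * c.ε₁ ≤ R)
    (hW : ∀ Y, ∀ i ∈ s Y, ∀ φ ∈ Wt.sp1 Y, AnalyticOnNhd ℂ (Wf Y i φ) (ball 0 R))
    (hKW : ∀ Y, ∀ i ∈ s Y, ∀ φ ∈ Wt.sp1 Y, ∀ z ∈ ball (0 : E) R,
      ‖Wf Y i φ z‖ ≤ K₂ * Real.exp (-(c.κ₁ - 1) * ((Y.1.card : ℝ) - 1)) * ‖z‖ ^ 3)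
    (hcard : ∀ Y, (s Y).card ≤ m₂ * Y.1.card)
    (hV : ∀ Y, Wt.V Y = fun φ => (∑ i ∈ s Y, scaled g (Wf Y i φ) (rd Y φ)) + Wt.Vpp Y φ)
    (hQ : ∀ Y φ (b b' : Wt.Bond), φ ∈ Wt.sp1 Y →
      Wt.Q Y φ b b' = 2 * ∑ i ∈ s Y, Qop (scaled g (Wf Y i φ)) (rd Y φ) (e Y b) (e Y b'))
    (hsp : ∀ Y φ, φ ∈ Wt.sp1 Y → ‖g‖ * ‖rd Y φ‖ < c.ε₁)
    (hvolk : ∀ Y, Wt.volk Y = Y.1.card)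
    (hfloor : 27 * m₂ * K₂ * Real.exp (c.κ₁ - 1) ≤ c.C₃ * c.M ^ 4 * Real.exp (c.C₂ * c.κ₁))
    (hAnP : ∀ Y, ∀ i ∈ s Y, Wt.Analytic (fun φ => scaled g (Wf Y i φ) (rd Y φ)) (Wt.sp1 Y))
    (hG : ∀ Y, Wt.GaugeInv (Wt.V Y) ∧ Wt.GaugeInv (Wt.toStepData.quadForm Y) ∧ Wt.GaugeInv (Wt.Vpp Y))
    -- (3) LEMMA 3 (pp. 14–20): the signs of (2.18)–(2.20), R12, |τ(Y)| ≥ 2, and the numerics bundle at ℓ = ½L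
    (M₃ : ℕ) [NeZero M₃] {a a₂ a₂' a₅ Aabs : ℝ} (hN : Lemma3Numerics c M₃ ((c.L : ℝ) / 2) a a₂ a₂' a₅ Aabs)
    (h12 : R12 c) (hE : 0 < c.E₀) (hε : 0 < c.ε₁) (hC₁ : 0 < c.C₁) (hα : 0 < c.α₄) (hM : 1 ≤ c.M)
    (hτ2 : c.E₀ * c.ε₁ * c.C₁ * c.α₄⁻¹ * c.M ^ c.q * Real.exp (c.C₂ * c.κ₁) ≤ 1 / 2)
    -- (3) the Cauchy radius and the parameter domains (p. 15)
    {Uσ Uτ : Set ℂ} (hUσ : IsOpen Uσ) (hUτ : IsOpen Uτ) (hUexp : Metric.closedBall (0 : ℂ) (Real.exp c.κ₁) ⊆ Uσ)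
    (hUtau : ∀ Y : TDom 4 (L * (𝓣 s₀).N'),
      Metric.closedBall (0 : ℂ) ((invTau c ((tsys 4 (L * (𝓣 s₀).N')).dj Y))⁻¹) ⊆ Uτ)
    {r : ℝ} (hr : 0 < r) (hr' : r ≤ Real.exp c.κ₁ - 1)
    (hsubτ : ∀ x ∈ Set.uIcc (0 : ℝ) 1, Metric.closedBall (x : ℂ) r ⊆ Uτ)
    -- (3) THE DICTIONARY: the (2.14)-term (𝐃, P) = t of Z ∈ 𝐃_{k+1} is the term `idx Z t` of the member `s₀` (its
    --     extra columns finite), read at the configuration `u = uOf Z t φ ∈ (𝓣 s₀).E` of `φ ∈ sp2 Z`, of size ≤ α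
    (idx : TDom 4 (𝓣 s₀).N' → Finset (TDom 4 (L * (𝓣 s₀).N')) × Finset (TBond 4 M₃ (L * (𝓣 s₀).N')) → (𝓣 s₀).ι)
    [∀ Z t, Fintype ((𝓣 s₀).𝒦 (idx Z t)).C₀] [∀ Z t, DecidableEq ((𝓣 s₀).𝒦 (idx Z t)).C₀]
    (uOf : (Z : TDom 4 (𝓣 s₀).N') → (t : Finset (TDom 4 (L * (𝓣 s₀).N')) × Finset (TBond 4 M₃ (L * (𝓣 s₀).N'))) →
      Wt.Φ → (𝓣 s₀).E)
    {α : ℝ} (hαnn : 0 ≤ α) (huα : ∀ Z, ∀ t ∈ terms L M₃ Z, ∀ φ ∈ Wt.sp2 Z, ‖uOf Z t φ‖ ≤ α)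
    -- (3) per term: parameter lists, the linear map Γ(σ), characteristic functions, potentials
    (lZ : TDom 4 (𝓣 s₀).N' → Finset (TDom 4 (L * (𝓣 s₀).N')) × Finset (TBond 4 M₃ (L * (𝓣 s₀).N')) →
      List (TPt 4 (𝓣 s₀).N'))
    (hlZ : ∀ Z, ∀ t ∈ terms L M₃ Z, (lZ Z t).Nodup ∧ (lZ Z t).toFinset = Z.1 \ tclosure L (𝓣 s₀).N' (Z0 M₃ t))
    (lD : TDom 4 (𝓣 s₀).N' → Finset (TDom 4 (L * (𝓣 s₀).N')) × Finset (TBond 4 M₃ (L * (𝓣 s₀).N')) →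
      List (TDom 4 (L * (𝓣 s₀).N')))
    (hlD : ∀ Z, ∀ t ∈ terms L M₃ Z, (lD Z t).Nodup ∧ (lD Z t).toFinset = t.1)
    (Γm : (Z : TDom 4 (𝓣 s₀).N') → (t : Finset (TDom 4 (L * (𝓣 s₀).N')) × Finset (TBond 4 M₃ (L * (𝓣 s₀).N'))) → Wt.Φ →
      (TPt 4 (𝓣 s₀).N' → ℂ) → (((𝓣 s₀).𝒦 (idx Z t)).Λ ⊕ ((𝓣 s₀).𝒦 (idx Z t)).C₀ → ℝ) → (((𝓣 s₀).𝒦 (idx Z t)).Λ → ℂ))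
    (χY₀ χcP : (Z : TDom 4 (𝓣 s₀).N') → (t : Finset (TDom 4 (L * (𝓣 s₀).N')) × Finset (TBond 4 M₃ (L * (𝓣 s₀).N'))) →
      (((𝓣 s₀).𝒦 (idx Z t)).Λ → ℝ) → ℝ)
    (hχ0 : ∀ Z t B, 0 ≤ χY₀ Z t B) (hχ1 : ∀ Z t B, χY₀ Z t B ≤ 1)
    (Pl : (Z : TDom 4 (𝓣 s₀).N') → (t : Finset (TDom 4 (L * (𝓣 s₀).N')) × Finset (TBond 4 M₃ (L * (𝓣 s₀).N'))) → Finset ((𝓣 s₀).𝒦 (idx Z t)).Λ)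
    (hPcard : ∀ Z, ∀ t ∈ terms L M₃ Z, (Pl Z t).card = t.2.card) {rP : ℝ} (hrP : 0 ≤ rP)
    (hχc : ∀ Z t B, χcP Z t B = ∏ b ∈ Pl Z t, (if rP ≤ |B b| then (1 : ℝ) else 0))
    (Dfam : TDom 4 (𝓣 s₀).N' → Finset (TDom 4 (L * (𝓣 s₀).N')) × Finset (TBond 4 M₃ (L * (𝓣 s₀).N')) → Finset (TDom 4 (L * (𝓣 s₀).N')))
    (Vr : (Z : TDom 4 (𝓣 s₀).N') → (t : Finset (TDom 4 (L * (𝓣 s₀).N')) × Finset (TBond 4 M₃ (L * (𝓣 s₀).N'))) → Wt.Φ →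
      TDom 4 (L * (𝓣 s₀).N') → (((𝓣 s₀).𝒦 (idx Z t)).Λ → ℝ) → ℂ)
    -- (3) termwise domination: ‖H(Z)‖ ≤ Σ_{(𝐃,P)} ‖(2.14)‖ on the space of p. 15 ((2.9)/(2.14))
    (hH : ∀ (Z : TDom 4 (𝓣 s₀).N') (φ : Wt.Φ), φ ∈ Wt.sp2 Z → ‖Wt.H Z φ‖ ≤
      ∑ t ∈ terms L M₃ Z, ‖term214 r (lZ Z t) (lD Z t)
        (core214 (fun σ => ((𝓣 s₀).𝒦 (idx Z t)).A2 σ (uOf Z t φ)) (Γm Z t φ)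
          (F214 t.2.card (χY₀ Z t) (χcP Z t) (Dfam Z t) (Vr Z t φ))) 0 0‖)
    -- (3) the record's objects behind the terms: bonds, cubes, the real field inside the configurations
    (ιb : (Z : TDom 4 (𝓣 s₀).N') → (t : Finset (TDom 4 (L * (𝓣 s₀).N')) × Finset (TBond 4 M₃ (L * (𝓣 s₀).N'))) → ((𝓣 s₀).𝒦 (idx Z t)).Λ → Wt.Bond)
    (hι : ∀ Z t, Function.Injective (ιb Z t)) (cube : Wt.Bond → TPt 4 (L * (𝓣 s₀).N'))
    (hQsupp : ∀ (Y : TDom 4 (L * (𝓣 s₀).N')) φ b b', Wt.Q Y φ b b' ≠ 0 → cube b ∈ Y.1 ∧ cube b' ∈ Y.1)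
    {m' : ℕ} (hfibc : ∀ Z t (x : TPt 4 (L * (𝓣 s₀).N')), (Finset.univ.filter fun j => cube (ιb Z t j) = x).card ≤ m')
    (emb : (Z : TDom 4 (𝓣 s₀).N') → (t : Finset (TDom 4 (L * (𝓣 s₀).N')) × Finset (TBond 4 M₃ (L * (𝓣 s₀).N'))) → Wt.Φ →
      (((𝓣 s₀).𝒦 (idx Z t)).Λ → ℝ) → Wt.Φ)
    (hBv : ∀ Z t φ B b, Wt.Bv (emb Z t φ B) (ιb Z t b) = (B b : ℂ))
    (hBv0 : ∀ Z t φ B b', b' ∉ Set.range (ιb Z t) → Wt.Bv (emb Z t φ B) b' = 0)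
    (hVr : ∀ Z, ∀ t ∈ terms L M₃ Z, ∀ φ ∈ Wt.sp2 Z, ∀ Y ∈ Dfam Z t, ∀ B,
      emb Z t φ B ∈ Wt.sp1 Y → Vr Z t φ Y B = Wt.V Y (emb Z t φ B))
    (hχsupp : ∀ Z, ∀ t ∈ terms L M₃ Z, ∀ φ ∈ Wt.sp2 Z, ∀ B, χY₀ Z t B ≠ 0 → ∀ Y ∈ Dfam Z t,
      emb Z t φ B ∈ Wt.sp1 Y)
    -- (3) separate holomorphy of the X-integral in (σ, τ)
    (hΨσ : ∀ Z, ∀ t ∈ terms L M₃ Z, ∀ φ ∈ Wt.sp2 Z, ∀ τ : TDom 4 (L * (𝓣 s₀).N') → ℂ, (∀ j, τ j ∈ Uτ) →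
      SepHolOn Uσ (fun σ => core214 (fun σ => ((𝓣 s₀).𝒦 (idx Z t)).A2 σ (uOf Z t φ)) (Γm Z t φ)
        (F214 t.2.card (χY₀ Z t) (χcP Z t) (Dfam Z t) (Vr Z t φ)) σ τ))
    (hΨτ : ∀ Z, ∀ t ∈ terms L M₃ Z, ∀ φ ∈ Wt.sp2 Z, ∀ σ : TPt 4 (𝓣 s₀).N' → ℂ, (∀ j, σ j ∈ Uσ) →
      SepHolOn Uτ (fun τ => core214 (fun σ => ((𝓣 s₀).𝒦 (idx Z t)).A2 σ (uOf Z t φ)) (Γm Z t φ)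
        (F214 t.2.card (χY₀ Z t) (χcP Z t) (Dfam Z t) (Vr Z t φ)) σ τ))
    -- (3) NODE A's structural inputs at the configuration: A(σ) COMPLEX SYMMETRIC on the polydisc; Γ(σ) = G(σ)·
    (hAs : ∀ Z, ∀ t ∈ terms L M₃ Z, ∀ φ ∈ Wt.sp2 Z, ∀ σ : TPt 4 (𝓣 s₀).N' → ℂ, (∀ j, ‖σ j‖ ≤ Real.exp c.κ₁) →
      (((𝓣 s₀).𝒦 (idx Z t)).A2 σ (uOf Z t φ)).IsSymm)
    (hlin : ∀ Z, ∀ t ∈ terms L M₃ Z, ∀ φ ∈ Wt.sp2 Z, ∀ σ : TPt 4 (𝓣 s₀).N' → ℂ, (∀ j, ‖σ j‖ ≤ Real.exp c.κ₁) →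
      ∀ X : ((𝓣 s₀).𝒦 (idx Z t)).Λ ⊕ ((𝓣 s₀).𝒦 (idx Z t)).C₀ → ℝ, Γm Z t φ σ X = ((𝓣 s₀).𝒦 (idx Z t)).G2 σ (uOf Z t φ) *ᵥ fun j => (X j : ℂ))
    {γ₂ : ℝ} (hγ₂ : 0 ≤ γ₂)
    -- (3) uniform fibre bounds of the bond locations
    {m : ℕ}
    (hfibΛ : ∀ Z t (x : UT (𝓣 s₀).Nf), (Finset.univ.filter fun i => ((𝓣 s₀).𝒦 (idx Z t)).locΛ i = x).card ≤ m)
    (hfibN : ∀ Z t (x : UT (𝓣 s₀).Nf), (Finset.univ.filter fun j => ((𝓣 s₀).𝒦 (idx Z t)).locN j = x).card ≤ m)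
    -- (3) THE RUNG's PACKAGE: admissible with positive rates, `η ≤ etaMax` (standard rate book, `κ_C = q.kapCStar`,
    --     `ρ′ = q.mu/4`), `α < R`, round letters, and PRINT's TWO THRESHOLDS for a `θ₀ > 0`
    (hq : q.Admissible) (hp : q.PositiveRates) (hη : q.η ≤ q.etaMax) (hαR : α < q.R)
    {KG KCs θ₀ : ℝ} (hKG : q.Kbar ≤ KG) (hKCs : 4 / q.mA ≤ KCs) (hθ₀ : 0 < θ₀)
    (hαsmall : α ≤ θ₀ * q.R / (4 * q.Kbar + 4))
    (hRσlarge : Real.log ((4 * q.Kbar + 4) / θ₀) / (q.mu / 4 - q.kapCStar) ≤ q.Rσ)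
    -- (3) rates below the rung's κ_C⋆, and NODE A's letter ϑ (θ_Γ = θ_E = θ₀, K_Γ = K_G, K₀′ = K_Cs, θ_C derived)
    {kap kap' kap'' kap₂ ϑ : ℝ} (hkap'' : 0 < kap'') (hk1 : kap'' < kap') (hk2 : kap' < kap) (hk3 : kap < kap₂)
    (hk4 : kap₂ < q.kapCStar) (hθ₀le : θ₀ ≤ ϑ)
    (hθR1le : (m * (1 + 2 / (kap - kap')) ^ (𝓣 s₀).ν) * (m * (1 + 2 / (kap' - kap'')) ^ (𝓣 s₀).ν)
      * (θ₀ * KCs * KG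
        + KG * (KCs * θ₀ * (m * (1 + 2 / (q.kapCStar - kap₂)) ^ (𝓣 s₀).ν) * KCs
          * (m * (1 + 2 / (kap₂ - kap)) ^ (𝓣 s₀).ν)) * KG
        + KG * KCs * θ₀) ≤ ϑ)
    (hsmallKθ : KCs * (m * (1 + 2 / kap) ^ (𝓣 s₀).ν) * (ϑ * (m * (1 + 2 / kap'') ^ (𝓣 s₀).ν)) < 1)
    -- (3) the (2.24)–(2.25) smallness with `a₂₀ = m′·α₄·M⁻⁴(1 + 32/(κ₁−1))⁴`; `1∕m_A ≤ cE`; the form bound of Γ₀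
    {cE gq : ℝ} (hc0 : 0 ≤ cE)
    (hcE : 1 / q.mA ≤ cE)
    (hαc : (2 * (ϑ * (m * (1 + 2 / kap'') ^ (𝓣 s₀).ν)) +
      (γ₂ + m' * c.α₄ * (c.M ^ 4)⁻¹ * (1 + 32 / (c.κ₁ - 1)) ^ 4)) * cE ≤ 1 / 2) (hgq : 0 ≤ gq)
    (hΓq : ∀ Z, ∀ t ∈ terms L M₃ Z, ∀ X : ((𝓣 s₀).𝒦 (idx Z t)).Λ ⊕ ((𝓣 s₀).𝒦 (idx Z t)).C₀ → ℝ,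
      (((𝓣 s₀).𝒦 (idx Z t)).Γ₀ *ᵥ X) ⬝ᵥ (((𝓣 s₀).𝒦 (idx Z t)).C *ᵥ (((𝓣 s₀).𝒦 (idx Z t)).Γ₀ *ᵥ X)) ≤ gq * (X ⬝ᵥ X))
    (hsmall : (2 * (ϑ * (m * (1 + 2 / kap'') ^ (𝓣 s₀).ν)) +
      (γ₂ + m' * c.α₄ * (c.M ^ 4)⁻¹ * (1 + 32 / (c.κ₁ - 1)) ^ 4)) * (1 + 2 * cE * gq) ≤ 1 / 2)
    -- (3) constant matching, p. 17: `a ≤ γ₂ r_P²` and the volume factor with `w = K₀(64,8)·α₄·#(⋃𝐃)`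
    (hPa : a ≤ γ₂ * rP ^ 2)
    (hvol : ∀ Z, ∀ t ∈ terms L M₃ Z,
      2 * (KCs * (m * (1 + 2 / kap) ^ (𝓣 s₀).ν) * (ϑ * (m * (1 + 2 / kap'') ^ (𝓣 s₀).ν))
              * (1 + (1 - KCs * (m * (1 + 2 / kap) ^ (𝓣 s₀).ν) * (ϑ * (m * (1 + 2 / kap'') ^ (𝓣 s₀).ν)))⁻¹) / 2)
          * (Fintype.card ((𝓣 s₀).𝒦 (idx Z t)).Λ : ℝ)
        + K₀ 64 8 * c.α₄ * ((((Dfam Z t).image Subtype.val).biUnion id).card : ℝ)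
        + (2 * (ϑ * (m * (1 + 2 / kap'') ^ (𝓣 s₀).ν)) +
            (γ₂ + m' * c.α₄ * (c.M ^ 4)⁻¹ * (1 + 32 / (c.κ₁ - 1)) ^ 4)) * cE * (Fintype.card ((𝓣 s₀).𝒦 (idx Z t)).Λ : ℝ)
        + (2 * (ϑ * (m * (1 + 2 / kap'') ^ (𝓣 s₀).ν)) +
            (γ₂ + m' * c.α₄ * (c.M ^ 4)⁻¹ * (1 + 32 / (c.κ₁ - 1)) ^ 4)) * (1 + 2 * cE * gq)
            * (Fintype.card (((𝓣 s₀).𝒦 (idx Z t)).Λ ⊕ ((𝓣 s₀).𝒦 (idx Z t)).C₀) : ℝ)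
        ≤ a₅ * ((Z.1).card : ℝ)) :
    B13.Lemma1Printed Wt.toStepData c ∧ B13.Lemma2Printed Wt.toStepData c ∧ B13.Lemma3Printed Wt.toStepData c := by
  -- the standard rate book decays, and print's two thresholds give the exchange inequality
  have hpos := WalkPackage.stdRates_pos q hq hp hη
  have hθ : 2 * q.Kbar * (Real.exp (-(((q.stdRates hq hp hη).ρ' - (q.stdRates hq hp hη).κC) * q.Rσ)) + α / q.R)
      ≤ θ₀ :=
    exchange_of_thresholds hq (q.stdRates hq hp hη) hpos.2.1 hθ₀ hαsmall hRσlarge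
  exact b13Leaf_twoTorus_walks₂ Wt c k hN12 hL8 hLc S0 F Sq SX T Sc Sq' SX' T' dist h133 hS0Y hFsub hSq hScY hdist0
    hdist hSX hSX' hX0 hAdd hZero hAnT hAnT' hK hK' hκ hδ1 hδκ hκ126 hκ126' hκ₁ hκ₁' hδ₀M hδ₀M5 hR8 hR9 h124 h130
    hθ0 hθ1 hC Gl hVpp hGlAn hGl rd e he hrd s Wf hg hK₂ hR h3 hW hKW hcard hV hQ hsp hvolk hfloor hAnP hG M₃ hN h12
    hE hε hC₁ hα hM hτ2 hUσ hUτ hUexp hUtau hr hr' hsubτ (fun Z t => (𝓣 s₀).𝒦 (idx Z t)) uOf hαnn huα lZ hlZ lD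
    hlD Γm χY₀ χcP hχ0 hχ1 Pl hPcard hrP hχc Dfam Vr hH ιb hι cube hQsupp hfibc emb hBv hBv0 hVr hχsupp hΨσ hΨτ hAs
    hlin hγ₂ hfibΛ hfibN q hq (q.stdRates hq hp hη) hpos.1 hpos.2.1.le hαR
    (fun Z t _ => termWalks_of_uniformWalksAcross hall s₀ (idx Z t)) hKG hKCs hθ hkap'' hk1 hk2 hk3 hk4 hθ₀le
    hθR1le hsmallKθ hc0 hcE hαc hgq hΓq hsmall hPa hvol

end Across

/-! ## §4. (A2)-style compatibility: NODE A's letter `ϑ` is met by a small enough `θ₀` -/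

/-- **ANY TARGET SMALLNESS `ϑ > 0` OF NODE A IS MET BY THE RUNG's LETTERS AT A SMALL ENOUGH `θ₀`.**  For round letters
`K_G, K_Cs ≥ 0`, a rate chain `κ″ < κ′ < κ < κ₂ < κ_C`, fibre bound `m` and torus factor count `ν`, the letter inequality
`hθR1le` of `B13NodeTorusWalks.b13Leaf_twoTorus_walks` is LINEAR in `θ₀`: `θ₀·D ≤ ϑ` with
`D = (m(1+2∕(κ−κ′)))^ν (m(1+2∕(κ′−κ″)))^ν (K_Cs K_G + K_G θ_C′ K_G + K_G K_Cs) ≥ 0` (`θ_C′` the derived covariance factor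
without `θ₀`), so `θ₀ := ϑ∕(1 + D) ∈ ]0, ϑ]` meets it — and print's two thresholds at that `θ₀` (α ≤ θ₀R∕(4K̄+4),
R_σ ≥ log((4K̄+4)∕θ₀)∕(ρ′−κ_C): `exchange_of_thresholds`) give the exchange inequality.  Pure arithmetic: the NEW numeric
coupling introduced by reading L17a∕L16a off the rung is jointly satisfiable with any prescribed NODE-A letter.
[cite: Balaban1988RG2Cluster, (1.11) p.5, p.13, p.15, (2.24)–(2.26) p.17] -/
theorem exists_theta_of_vartheta {m ν : ℕ} {KG KCs kap kap' kap'' kap₂ κC ϑ : ℝ}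
    (hKG : 0 ≤ KG) (hKCs : 0 ≤ KCs) (hk1 : kap'' < kap') (hk2 : kap' < kap) (hk3 : kap < kap₂) (hk4 : kap₂ < κC)
    (hϑ : 0 < ϑ) :
    ∃ θ₀ : ℝ, 0 < θ₀ ∧ θ₀ ≤ ϑ ∧
      (m * (1 + 2 / (kap - kap')) ^ ν) * (m * (1 + 2 / (kap' - kap'')) ^ ν)
        * (θ₀ * KCs * KG
          + KG * (KCs * θ₀ * (m * (1 + 2 / (κC - kap₂)) ^ ν) * KCs * (m * (1 + 2 / (kap₂ - kap)) ^ ν)) * KG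
          + KG * KCs * θ₀) ≤ ϑ := by
  have hd1 : 0 < kap - kap' := sub_pos.2 hk2
  have hd2 : 0 < kap' - kap'' := sub_pos.2 hk1
  have hd3 : 0 < κC - kap₂ := sub_pos.2 hk4
  have hd4 : 0 < kap₂ - kap := sub_pos.2 hk3
  have ha : 0 ≤ (m : ℝ) * (1 + 2 / (kap - kap')) ^ ν := mul_nonneg (Nat.cast_nonneg m) (pow_nonneg (by positivity) ν)
  have hb : 0 ≤ (m : ℝ) * (1 + 2 / (kap' - kap'')) ^ ν := mul_nonneg (Nat.cast_nonneg m) (pow_nonneg (by positivity) ν)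
  have hc : 0 ≤ (m : ℝ) * (1 + 2 / (κC - kap₂)) ^ ν := mul_nonneg (Nat.cast_nonneg m) (pow_nonneg (by positivity) ν)
  have hd : 0 ≤ (m : ℝ) * (1 + 2 / (kap₂ - kap)) ^ ν := mul_nonneg (Nat.cast_nonneg m) (pow_nonneg (by positivity) ν)
  -- the slope D ≥ 0
  set D : ℝ := (m * (1 + 2 / (kap - kap')) ^ ν) * (m * (1 + 2 / (kap' - kap'')) ^ ν)
      * (KCs * KG + KG * (KCs * (m * (1 + 2 / (κC - kap₂)) ^ ν) * KCs * (m * (1 + 2 / (kap₂ - kap)) ^ ν)) * KG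
        + KG * KCs) with hD
  have hD0 : 0 ≤ D := by
    have h1 : 0 ≤ KCs * (m * (1 + 2 / (κC - kap₂)) ^ ν) * KCs * (m * (1 + 2 / (kap₂ - kap)) ^ ν) :=
      mul_nonneg (mul_nonneg (mul_nonneg hKCs hc) hKCs) hd
    have h2 : 0 ≤ KCs * KG + KG * (KCs * (m * (1 + 2 / (κC - kap₂)) ^ ν) * KCs * (m * (1 + 2 / (kap₂ - kap)) ^ ν)) * KG
        + KG * KCs := add_nonneg (add_nonneg (mul_nonneg hKCs hKG) (mul_nonneg (mul_nonneg hKG h1) hKG))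
          (mul_nonneg hKG hKCs)
    exact mul_nonneg (mul_nonneg ha hb) h2
  have h1D : 0 < 1 + D := by linarith
  refine ⟨ϑ / (1 + D), div_pos hϑ h1D, ?_, ?_⟩
  · rw [div_le_iff₀ h1D]; nlinarith
  · have hlin : (m * (1 + 2 / (kap - kap')) ^ ν) * (m * (1 + 2 / (kap' - kap'')) ^ ν)
        * (ϑ / (1 + D) * KCs * KG
          + KG * (KCs * (ϑ / (1 + D)) * (m * (1 + 2 / (κC - kap₂)) ^ ν) * KCs * (m * (1 + 2 / (kap₂ - kap)) ^ ν)) * KG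
          + KG * KCs * (ϑ / (1 + D))) = ϑ / (1 + D) * D := by
      rw [hD]; ring
    rw [hlin, div_mul_eq_mul_div, div_le_iff₀ h1D]
    nlinarith

end Literature.MathematicalPhysics.QuantumFieldTheory.Balaban1983to89.B13NodeTorusWalksAccretive

end
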